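import Literature.MathematicalPhysics.QuantumFieldTheory.Balaban1983to89.B6DualHolderTermMultiLevelBox
import Literature.MathematicalPhysics.QuantumFieldTheory.Balaban1983to89.B6Prop22HolderMultiLevelBox

/-!
# `Balaban1983to89.B6Prop22DualHolderMultiLevelBox` — [B6] PROPOSITION 2.2, FIFTH ENTRY OF (2.67) (`‖ζG′∇^{η*}λ‖_α`),
FOR THE GENUINE `k`-LEVEL OPERATOR `G′ = Δ′_a^{−1}` ON A BOX:
`|x̂−x|^{−α}|((G′∇^{η*}λ)(x̂) − (G′∇^{η*}λ)(x))| ≤ O(1)(L^jη)^{1−α}e^{−½δ₀d(y,y′)}|λ|`, `x, x̂ ∈ B^j(y)`, `supp λ ⊂ B^{j′}(y′)` —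
by the TRANSPOSED fixed point `G′∂ᵀ = G′₀ᵀ∂ᵀ + Rᵀ(G′∂ᵀ)` differenced over pairs and LIFTED to the index set
`pairs ⊕ sites`, with NO iteration: `D_α(G′∂ᵀ) = D_α(G′₀ᵀ∂ᵀ) + D_α(RᵀΛ)·(Λ^{−1}G′∂ᵀ)` (file 13 of the multi-level
parametrix; no existing module is touched; no fact is minted)

FRAMING (verbatim cell line):
statement-level skeleton of published theorems with citation tags; proofs where landed; nothing here is a claim about the Yang–Mills mass gap

Source under audit (cell pub-balaban / lit-balaban): T. Bałaban, *Propagators and renormalization transformations for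
lattice gauge theories. II*, Commun. Math. Phys. **96** (1984) 223–250 [`Balaban1984PropagatorsII`, "B6"], p. 234
[PDF 12] (2.64)–(2.67), Proposition 2.2; p. 232 [PDF 10] (2.50)–(2.55); p. 233–234 [PDF 11–12] Lemma 2.1
(2.59)–(2.63) (renders `run/shared/lean/pub/pub-balaban/b2b-balaban-ref1/pages/1984-cmp96-propagators-rt-II/
1984-cmp96-propagators-rt-II-p010/p011/p012-x2.png`); [3] = T. Bałaban, *Regularity and decay of lattice Green's
functions*, Commun. Math. Phys. **89** (1983) 571–597 [`Balaban1983RegularityDecay`], Theorem (1.9) p. 573.  Unit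
`lit-balaban-p21` (Phase-2 proof seat p21 gen 11), HOME `run/shared/lean/pub/lit-balaban/`, B6 fold owner r03,
referee ref-4.

## WHAT IS PRINTED (p. 234, verbatim up to notation)

«Let us formulate these results in Proposition 2.2. If we have (2.1), (2.2) and M is sufficiently large, then the
operator G′ = Δ′_a^{−1}(a = 1) satisfies the inequalities |(G′λ)(x)|, |(∇^η_xG′λ)(x)|, |(G′∇^{η*}λ)(x)|, ‖ζ∇^η_xG′λ‖_α,
‖ζG′∇^{η*}λ‖_α, |(Δ^ηG′λ)(x)| ≤ O(1)[(L^jη)², L^jη, L^jη, (L^jη)^{1−α}(‖ζ‖_α + |ζ|), (L^jη)^{1−α}(‖ζ‖_α + |ζ|), 1]·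
e^{−½δ₀d(y,y′)}|λ|, x ∈ B^j(y) or supp ζ ⊂ B^j(y), y ∈ Λ_j, supp λ ⊂ B^{j′}(y′), y′ ∈ Λ_{j′}. (2.67)» — preceded by
«The similar inequalities hold for a derivative of G′λ and for a Hölder norm of a derivative, but with (L^jη)² replaced
by L^jη and (L^jη)^{1−α} correspondingly.» (after (2.66)).

## WHAT THIS FILE CERTIFIES (kernel-checked; setting of files 1–12 of the multi-level parametrix)

For the genuine `k`-level operator `G′ = gml` of a nested family `D : Domains d ℓ M_h k P R` on the box, the backward
difference matrix `∂_μ = dMat μ`, the blocks `blkOf`/`bset D`/distance `d` of `geom D`, in lattice units, `0 ≤ α < 1`: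
* §1 the pairs `BPair D` (`x ≠ x̂` of one block), `blkB`, the Hölder-weighted difference `Dh` and the functional
  `dualOp D α M = Dh ∘ M`; `levW_one_mul_neg_one` (`ΛΛ^{−1} = 1`), `levW_neg_one_eq`; **`dual_identity`** —
  `liftL (D_α∘(G′D)) = liftL (D_α∘(G′₀ᵀD)) + liftL (D_α∘(RᵀΛ)) · liftR (Λ^{−1}G′D)` for any right factor `D`
  (`B6Prop22AdjMultiLevelBox.fixedPoint_transpose`, the lifts of `B6Prop22HolderMultiLevelBox`);
* §2 `dualZero_rowBound` — the pair rows of `G′₀ᵀ∂ᵀ`: `∃ δ, A > 0`,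
  `|x̂−x|^{−α}|(G′₀ᵀ∂ᵀλ)(x̂) − (G′₀ᵀ∂ᵀλ)(x)| ≤ A(L^j)^{1−α}e^{−δd(y,y′)/(d+1)}sup|λ|` (file 12 `aXt_dd_le` term by term, at most
  `6·2^{d+1}` terms carrying `h_□` at `x` or `x̂`); `dualPsi_rowBound` — the pair rows of `RᵀΛ`: `∃ δ, A > 0`,
  `|x̂−x|^{−α}|(RᵀΛf)(x̂) − (RᵀΛf)(x)| ≤ (A/M_h)(L^j)^{1−α}e^{−δd(y,y′)/(d+1)}sup|f|` (file 12 `bXt_dd_le`);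
* §3 **`hasMajorant_dualHolder_multiLevelBox`** — for `0 ≤ α < 1` there are `δ₀, C, M₀ > 0`, `N₀ ≥ 1` with: for every
  `k`, `M_h ≥ 3`, `L·M_h ≥ M₀`, `R ≥ 2L`, `RM ≥ N₀ + 1`, volume, nested family, weights in the windows with
  `a_{i+1} = aNext ℓ a_i c_i`, axis `μ`: `liftL (D_α∘(G′∂_μᵀ))` has the majorant `C·(L^{j(y)})^{1−α}·e^{−½δ₀d(y,y′)}` on
  `pairs ⊕ sites` (the identity of §1; §2; the third entry `B6Prop22AdjMultiLevelBox.prop22_third_multiLevelBox` conjugated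
  by `Λ^{−1}` (`hasMajorant_diagonal_mul`) and lifted (`hasMajorant_liftR`); `hasMajorant_mul` + the left convolution
  `conv_left_le` with Lemma 2.1 on the box (`lemma21_box`, `α′ = ½`); `hasMajorant_add`); and the printed form
  **`prop22_fifth_multiLevelBox`**:
  `|x̂−x|_∞^{−α}·|((G′∂_μᵀ)λ)(x̂) − ((G′∂_μᵀ)λ)(x)| ≤ C·(L^{j})^{1−α}·e^{−½δ₀d(y,y′)}·sup|λ|` for all `x ≠ x̂` of one block
  `B^j(y)` and `λ` supported in `B^{j′}(y′)`.
With files 5, 6, 9, 11, 7 (`prop22_first/second/third/fourth/sixth_multiLevelBox`) ALL SIX ENTRIES of (2.67) are now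
certified for the genuine `k`-level operator on a box.

## HONEST SCOPE

As files 1–12: levels `1 … k` on a Neumann box, `m² = 0`, the asymmetric partition (`u_□ = h_□`, `v_□ = h_□1_{B^j(Λ_j)}`),
`M_h ≥ 3`, `R ≥ 2L`; lattice units (`G′` here is `η^{−2}G′` of print, `∂ᵀ` the transposed unit backward difference —
`(G′∂ᵀλ)(x) = Σ_z[G′(x,z+e_μ) − G′(x,z)]λ(z)`, i.e. `η·G′∇^{η*}` of print up to sign —, the Hölder weight `|x̂−x|_∞^{−α}`
in fine sites, whence `(L^{j})^{1−α}` for «(L^jη)^{1−α}»); the Hölder pairs are the pairs `x ≠ x̂` of ONE block `B^j(y)`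
(print: «supp ζ ⊂ B^j(y)»), the cut-off `ζ` and the factor `(‖ζ‖_α + |ζ|)` being dispensed with as in [3] (1.9);
`0 ≤ α < 1` with rate AND constants depending on `α` (the cube Hölder clauses of the lineage are «∀α ∃δ»); the
(2.61)-constant is the `L`-dependent series constant of `B6Ineq261LevelGap`; «M sufficiently large» is the third
entry's threshold `M₀` (no further smallness is used: the identity of §1 is not iterated); constants existential.
Nothing is inferred from the manuscript: every step is kernel-checked.
-/

namespace Literature.MathematicalPhysics.QuantumFieldTheory.Balaban1983to89.B6Prop22DualHolderMultiLevelBox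

open Finset Matrix
open Literature.MathematicalPhysics.QuantumFieldTheory.Balaban1983to89.B4ContourShift (supNorm supNorm_nonneg)
open Literature.MathematicalPhysics.QuantumFieldTheory.Balaban1983to89.B4Reflection242 (boxDom mem_boxDom)
open Literature.MathematicalPhysics.QuantumFieldTheory.Balaban1983to89.B6Ineq243TwoLevelBox (aNext)
open Literature.MathematicalPhysics.QuantumFieldTheory.Balaban1983to89.B6MultiLevelBoxOperator
open Literature.MathematicalPhysics.QuantumFieldTheory.Balaban1983to89.B6Eq238MultiLevelBox
open Literature.MathematicalPhysics.QuantumFieldTheory.Balaban1983to89.B6Ineq249MultiLevelBox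
open Literature.MathematicalPhysics.QuantumFieldTheory.Balaban1983to89.B6Geom246MultiLevelBox
open Literature.MathematicalPhysics.QuantumFieldTheory.Balaban1983to89.B6Prop22MultiLevelBox
open Literature.MathematicalPhysics.QuantumFieldTheory.Balaban1983to89.B6Prop22DerivMultiLevelBox (dMat
  mem_keySet_of_uX_ne_zero)
open Literature.MathematicalPhysics.QuantumFieldTheory.Balaban1983to89.B6Prop22AdjMultiLevelBox (levW fixedPoint_transpose
  conv_left_le hasMajorant_diagonal_mul prop22_third_multiLevelBox)
open Literature.MathematicalPhysics.QuantumFieldTheory.Balaban1983to89.B6Prop22HolderMultiLevelBox (liftL liftR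
  liftL_apply_inl liftL_add liftL_mul_liftR hasMajorant_liftR hasMajorant_liftL rowBound_of_hasMajorant_liftL)
open Literature.MathematicalPhysics.QuantumFieldTheory.Balaban1983to89.B6DualHolderTermMultiLevelBox (aXt_dMatt_mulVec
  vX_eq_zero_of_uX aXt_dd_le bXt_col_eq_zero_of_uX bXt_dd_le)
open Literature.MathematicalPhysics.QuantumFieldTheory.Balaban1983to89.B6RandomWalk (HasMajorant BlockSupp
  hasMajorant_mono hasMajorant_add hasMajorant_mul Triangle254)
open Literature.MathematicalPhysics.QuantumFieldTheory.Balaban1983to89.B6Lemma21Repaired (Ineq261With)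
open Literature.MathematicalPhysics.QuantumFieldTheory.Balaban1983to89.B6Ineq261LevelGap (K261 K261_nonneg
  theta_lt_one_of_log)

noncomputable section

variable {d : ℕ}

/-! ## §0 Tools -/

section Tools

/-- a sum over a finite type whose non-zero terms are indexed injectively into a finset `T` and are bounded by
`B ≥ 0` is at most `|T|·B`. [folklore] -/
private theorem sum_le_card_mul {ι σ : Type*} [Fintype ι] [DecidableEq σ] (f : ι → ℝ) (key : ι → σ)
    (hkey : Function.Injective key) (T : Finset σ) (hT : ∀ i, f i ≠ 0 → key i ∈ T) {B : ℝ} (hB : 0 ≤ B)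
    (hf : ∀ i, f i ≤ B) : ∑ i, f i ≤ T.card * B := by
  classical
  rw [← Finset.sum_filter_ne_zero]
  have hcard : (Finset.univ.filter fun i => f i ≠ 0).card ≤ T.card :=
    Finset.card_le_card_of_injOn key (fun i hi => by
      rw [Finset.coe_filter] at hi; exact hT i hi.2) (fun i _ j _ h => hkey h)
  calc ∑ i ∈ Finset.univ.filter (fun i => f i ≠ 0), f i
      ≤ (Finset.univ.filter fun i => f i ≠ 0).card • B := Finset.sum_le_card_nsmul _ _ _ fun i _ => hf i
    _ = ((Finset.univ.filter fun i => f i ≠ 0).card : ℝ) * B := by rw [nsmul_eq_mul]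
    _ ≤ T.card * B := mul_le_mul_of_nonneg_right (by exact_mod_cast hcard) hB

end Tools

/-! ## §1 The same-block pairs, the Hölder-weighted difference, the functional of the fifth entry, the lifted identity -/

section Pairs

variable {ℓ Mh k R : ℕ} {P : Fin (d + 1) → ℕ}

/-- **THE PAIRS `x ≠ x̂` OF ONE BLOCK OF `𝔅`** (the two points of the Hölder quotient of `G′∇^{η*}λ`, «supp ζ ⊂ B^j(y)»).
[cite: Balaban1984PropagatorsII, (2.67) p.234 (fifth entry), dictionary] -/
structure BPair (D : Domains d ℓ Mh k P R) where
  /-- the first point -/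
  x : ↥(boxDom (N0 ℓ Mh k P))
  /-- the second point -/
  x' : ↥(boxDom (N0 ℓ Mh k P))
  /-- the points differ -/
  ne : x'.1 ≠ x.1
  /-- the points lie in one block of `𝔅` -/
  blk : blkOf D x' = blkOf D x

/-- pairs are determined by their two points. [folklore] -/
private theorem BPair.ext' {D : Domains d ℓ Mh k P R} {p q : BPair D} (hx : p.x = q.x) (hx' : p.x' = q.x') :
    p = q := by
  cases p; cases q
  simp only at hx hx'
  subst hx hx'
  rfl

/-- finitely many pairs. [cite: Balaban1984PropagatorsII, (2.67) p.234, dictionary] -/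
instance instFiniteBPair (D : Domains d ℓ Mh k P R) : Finite (BPair D) :=
  Finite.of_injective (fun p : BPair D => (p.x, p.x')) fun p q h => by
    simp only [Prod.mk.injEq] at h
    exact BPair.ext' h.1 h.2

/-- finitely many pairs. [cite: Balaban1984PropagatorsII, (2.67) p.234, dictionary] -/
noncomputable instance instFintypeBPair (D : Domains d ℓ Mh k P R) : Fintype (BPair D) := Fintype.ofFinite _

/-- equality of pairs is decidable (classically). [cite: Balaban1984PropagatorsII, (2.67) p.234, dictionary] -/
noncomputable instance instDecidableEqBPair (D : Domains d ℓ Mh k P R) : DecidableEq (BPair D) := Classical.decEq _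

/-- the block of a pair. [cite: Balaban1984PropagatorsII, p.231, dictionary] -/
def blkB (D : Domains d ℓ Mh k P R) : BPair D → ↥(bset D) := fun p => blkOf D p.x

/-- **THE HÖLDER-WEIGHTED DIFFERENCE OVER A PAIR** (lattice units): `(D_αf)(x, x̂) = |x̂ − x|_∞^{−α}·(f(x̂) − f(x))`.
[cite: Balaban1984PropagatorsII, (2.67) p.234 (fifth entry ‖ζG′∇^{η*}λ‖_α), dictionary] -/
def Dh (D : Domains d ℓ Mh k P R) (α : ℝ) : (↥(boxDom (N0 ℓ Mh k P)) → ℝ) →ₗ[ℝ] (BPair D → ℝ) where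
  toFun f p := (supNorm (p.x'.1 - p.x.1)) ^ (-α) * (f p.x' - f p.x)
  map_add' f f' := by
    funext p
    simp only [Pi.add_apply]
    ring
  map_smul' r f := by
    funext p
    simp only [Pi.smul_apply, smul_eq_mul, RingHom.id_apply]
    ring

/-- values of `Dh`. [cite: Balaban1984PropagatorsII, (2.67) p.234 (fifth entry), dictionary] -/
theorem Dh_apply (D : Domains d ℓ Mh k P R) (α : ℝ) (f : ↥(boxDom (N0 ℓ Mh k P)) → ℝ) (p : BPair D) :
    Dh D α f p = (supNorm (p.x'.1 - p.x.1)) ^ (-α) * (f p.x' - f p.x) := rfl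

/-- **THE FUNCTIONAL OF THE FIFTH ENTRY** applied to a kernel `M`: `T(M) = D_α ∘ M`.
[cite: Balaban1984PropagatorsII, (2.67) p.234 (fifth entry), dictionary] -/
def dualOp (D : Domains d ℓ Mh k P R) (α : ℝ) (M : Matrix ↥(boxDom (N0 ℓ Mh k P)) ↥(boxDom (N0 ℓ Mh k P)) ℝ) :
    (↥(boxDom (N0 ℓ Mh k P)) → ℝ) →ₗ[ℝ] (BPair D → ℝ) :=
  Dh D α ∘ₗ Matrix.toLin' M

/-- values of `dualOp`. [cite: Balaban1984PropagatorsII, (2.67) p.234 (fifth entry), dictionary] -/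
theorem dualOp_apply (D : Domains d ℓ Mh k P R) (α : ℝ) (M : Matrix ↥(boxDom (N0 ℓ Mh k P)) ↥(boxDom (N0 ℓ Mh k P)) ℝ)
    (f : ↥(boxDom (N0 ℓ Mh k P)) → ℝ) (p : BPair D) :
    dualOp D α M f p = (supNorm (p.x'.1 - p.x.1)) ^ (-α) * ((M *ᵥ f) p.x' - (M *ᵥ f) p.x) := by
  unfold dualOp
  rw [LinearMap.comp_apply, Matrix.toLin'_apply, Dh_apply]

/-- `T(M + M′) = T(M) + T(M′)`. [cite: Balaban1984PropagatorsII, (2.67) p.234 (fifth entry), dictionary] -/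
theorem dualOp_add (D : Domains d ℓ Mh k P R) (α : ℝ) (M M' : Matrix ↥(boxDom (N0 ℓ Mh k P)) ↥(boxDom (N0 ℓ Mh k P)) ℝ) :
    dualOp D α (M + M') = dualOp D α M + dualOp D α M' := by
  unfold dualOp
  rw [map_add, LinearMap.comp_add]

/-- `T(M·M′) = T(M) ∘ M′`. [cite: Balaban1984PropagatorsII, (2.67) p.234 (fifth entry), dictionary] -/
theorem dualOp_mul (D : Domains d ℓ Mh k P R) (α : ℝ) (M M' : Matrix ↥(boxDom (N0 ℓ Mh k P)) ↥(boxDom (N0 ℓ Mh k P)) ℝ) :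
    dualOp D α (M * M') = dualOp D α M ∘ₗ Matrix.toLin' M' := by
  unfold dualOp
  rw [Matrix.toLin'_mul, LinearMap.comp_assoc]

/-- `ΛΛ^{−1} = 1` for the level weights `Λ = diag(L^{j(x)})`. [cite: Balaban1984PropagatorsII, (2.67) p.234 (the factor L^jη), dictionary] -/
theorem levW_one_mul_neg_one (D : Domains d ℓ Mh k P R) : levW D 1 * levW D (-1) = 1 := by
  unfold levW
  rw [Matrix.diagonal_mul_diagonal, ← Matrix.diagonal_one]
  refine congrArg Matrix.diagonal (funext fun x => ?_)
  have hL : (((ℓ : ℝ) + 1) ^ D.lev x.1) ≠ 0 := by positivity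
  rw [zpow_one, _root_.zpow_neg_one, mul_inv_cancel₀ hL]

/-- `Λ^{−1} = diag(L^{−j(y(x))})`. [cite: Balaban1984PropagatorsII, (2.67) p.234 (the factor L^jη), dictionary] -/
theorem levW_neg_one_eq (D : Domains d ℓ Mh k P R) :
    levW D (-1) = Matrix.diagonal (fun x => (((ℓ : ℝ) + 1) ^ (blkOf D x).1.1)⁻¹) := by
  unfold levW
  refine congrArg Matrix.diagonal (funext fun x => ?_)
  rw [_root_.zpow_neg_one]
  rfl

/-- **THE LIFTED IDENTITY OF THE FIFTH ENTRY** (no iteration): with `V = G′∂ᵀ`, `T = D_α∘V`, `T₀ = D_α∘(G′₀ᵀ∂ᵀ)`,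
`Ψ = D_α∘(RᵀΛ)`, `Ṽ = Λ^{−1}V`: `liftL T = liftL T₀ + liftL Ψ · liftR Ṽ` — from the transposed fixed point
`G′∂ᵀ = G′₀ᵀ∂ᵀ + Rᵀ(G′∂ᵀ)` ((2.38)/(2.50), `G′ᵀ = G′`) and `ΛΛ^{−1} = 1`.
[cite: Balaban1984PropagatorsII, (2.38) p.229, (2.50) p.232, (2.66)–(2.67) p.234 (fifth entry)] -/
theorem dual_identity (D : Domains d ℓ Mh k P R) {a c : ℕ → ℝ} (hℓ : 1 ≤ ℓ) (hR : 2 * (ℓ + 1) ≤ R)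
    (hP : ∀ μ, 1 ≤ P μ) (hMh : 1 ≤ Mh) (ha : ∀ i, 1 ≤ i → 0 < a i) (hcpos : ∀ i, 1 ≤ i → 0 < c i)
    (hac : ∀ i, 1 ≤ i → a (i + 1) = aNext ℓ (a i) (c i)) (α : ℝ)
    (Dm : Matrix ↥(boxDom (N0 ℓ Mh k P)) ↥(boxDom (N0 ℓ Mh k P)) ℝ) :
    liftL (dualOp D α (gml (N0 ℓ Mh k P) ℓ k D.lev a * Dm))
      = liftL (dualOp D α ((gZeroML D a c hP)ᵀ * Dm))
        + liftL (dualOp D α ((rML D a c hP)ᵀ * levW D 1))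
          * liftR (Matrix.toLin' (levW D (-1) * (gml (N0 ℓ Mh k P) ℓ k D.lev a * Dm))) := by
  have hfix := fixedPoint_transpose D (c := c) hℓ hR hP hMh ha hcpos hac Dm
  have hins : (rML D a c hP)ᵀ * (gml (N0 ℓ Mh k P) ℓ k D.lev a * Dm)
      = ((rML D a c hP)ᵀ * levW D 1) * (levW D (-1) * (gml (N0 ℓ Mh k P) ℓ k D.lev a * Dm)) := by
    rw [Matrix.mul_assoc, ← Matrix.mul_assoc (levW D 1), levW_one_mul_neg_one, Matrix.one_mul]
  conv_lhs => rw [hfix, hins]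
  rw [dualOp_add, dualOp_mul D α ((rML D a c hP)ᵀ * levW D 1), liftL_add, liftL_mul_liftR]

end Pairs

/-! ## §2 The pair-row bounds of `T₀ = D_α∘(G′₀ᵀ∂ᵀ)` and of `Ψ = D_α∘(RᵀΛ)`: the sums over the cover -/

section RowBounds

variable {ℓ Mh k R : ℕ} {P : Fin (d + 1) → ℕ}

/-- **THE PAIR ROWS OF `G′₀ᵀ∂ᵀ`, GENUINE `k`-LEVEL OPERATOR**: for `0 ≤ α < 1` there are `δ, A > 0` (functions of `d`,
`ℓ`, `α`, the windows) such that for every `k`, `M_h ≥ 3`, `R ≥ 2L`, volume, nested family, weights in the windows,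
axis `μ`, every `λ` supported in a block `y′` with `|λ| ≤ B` and every pair `(x, x̂)` of one block `B^j(y)`:
`|x̂−x|_∞^{−α}·|(G′₀ᵀ∂_μᵀλ)(x̂) − (G′₀ᵀ∂_μᵀλ)(x)| ≤ A·(L^{j})^{1−α}·e^{−δd(y,y′)/(d+1)}·|λ|` — the terms of
`G′₀ᵀ∂ᵀ = Σ_□ v_□G′(□)h_□∂ᵀ` one by one (file 12 `aXt_dd_le`), at most `6·2^{d+1}` of them carrying `h_□` at `x` or `x̂`.
[cite: Balaban1984PropagatorsII, (2.64)–(2.67) p.234 (fifth entry, the G′₀ factor), (2.43) p.230] -/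
theorem dualZero_rowBound (d ℓ : ℕ) (hℓ : 1 ≤ ℓ) (aminus aplus a2minus a2plus : ℝ) (ha : 0 < aminus)
    (ha2 : 0 < a2minus) (α : ℝ) (hα0 : 0 ≤ α) (hα1 : α < 1) :
    ∃ δ A : ℝ, 0 < δ ∧ 0 < A ∧ ∀ (k Mh R : ℕ), 3 ≤ Mh → 2 * (ℓ + 1) ≤ R →
      ∀ (P : Fin (d + 1) → ℕ) (hP : ∀ μ, 1 ≤ P μ) (D : Domains d ℓ Mh k P R) (a c : ℕ → ℝ),
        (∀ i, 1 ≤ i → aminus ≤ a i ∧ a i ≤ aplus) → (∀ i, 1 ≤ i → a2minus ≤ c i ∧ c i ≤ a2plus) →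
        ∀ (μ : Fin (d + 1)) (y' : ↥(bset D)) (lam : ↥(boxDom (N0 ℓ Mh k P)) → ℝ) (B : ℝ),
          BlockSupp (g := geom D) (blkOf D) lam y' B → ∀ p : BPair D,
          |dualOp D α ((gZeroML D a c hP)ᵀ * (dMat (N0 ℓ Mh k P) μ)ᵀ) lam p|
            ≤ A * (((ℓ : ℝ) + 1) ^ (blkB D p).1.1) ^ (1 - α)
              * Real.exp (-(δ / (d + 1) * (geom D).dist (blkB D p) y')) * B := by
  obtain ⟨δ₅, Q, hδ₅, hQ, hterm⟩ := aXt_dd_le d ℓ hℓ aminus aplus a2minus a2plus ha ha2 α hα0 hα1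
  refine ⟨δ₅, 6 * 2 ^ (d + 1) * Q + 1, hδ₅, by positivity, ?_⟩
  intro k Mh R hMh hR P hP D a c haw hcw μ y' lam B hlam p
  have hMh1 : 1 ≤ Mh := le_trans (by norm_num) hMh
  have hB0 : 0 ≤ B := hlam.nonneg
  have hlev : (blkB D p).1.1 = D.lev p.x.1 := rfl
  have hblkB : blkB D p = blkOf D p.x := rfl
  rw [hlev, hblkB]
  obtain ⟨E5, hE5⟩ : ∃ t : ℝ, t = Real.exp (-(δ₅ / (d + 1) * (geom D).dist (blkOf D p.x) y')) := ⟨_, rfl⟩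
  obtain ⟨LJ, hLJ⟩ : ∃ t : ℝ, t = (((ℓ : ℝ) + 1) ^ D.lev p.x.1) ^ (1 - α) := ⟨_, rfl⟩
  rw [← hE5, ← hLJ]
  have hE50 : 0 ≤ E5 := by rw [hE5]; exact (Real.exp_pos _).le
  have hLJ0 : 0 ≤ LJ := by rw [hLJ]; exact Real.rpow_nonneg (by positivity) _
  have hs0 : 0 < supNorm (p.x'.1 - p.x.1) :=
    lt_of_lt_of_le one_pos (B4StripSumsHolder.one_le_supNorm (sub_ne_zero.2 p.ne))
  have hW0 : 0 ≤ (supNorm (p.x'.1 - p.x.1)) ^ (-α) := Real.rpow_nonneg hs0.le _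
  -- one term
  obtain ⟨E, hE⟩ : ∃ t : ℝ, t = LJ * (Q * E5 * B) := ⟨_, rfl⟩
  have hEnn : 0 ≤ E := by rw [hE]; positivity
  have hone : ∀ (cq : ℕ × (Fin (d + 1) → ℤ)) (hc : CubeData D cq),
      |(supNorm (p.x'.1 - p.x.1)) ^ (-α)
        * ((((aX D a c hP cq hc)ᵀ * (dMat (N0 ℓ Mh k P) μ)ᵀ) *ᵥ lam) p.x'
          - (((aX D a c hP cq hc)ᵀ * (dMat (N0 ℓ Mh k P) μ)ᵀ) *ᵥ lam) p.x)| ≤ E := by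
    intro cq hc
    rw [abs_mul, abs_of_nonneg hW0, hE, hLJ, hE5]
    exact hterm k Mh R hMh hR P hP D a c haw hcw μ y' lam B hlam p.x p.x' p.ne p.blk cq hc
  -- the sum over the cover
  rw [dualOp_apply]
  unfold gZeroML
  rw [Matrix.transpose_sum, Finset.sum_mul, Matrix.sum_mulVec, Finset.sum_apply, Finset.sum_apply,
    ← Finset.sum_sub_distrib, Finset.mul_sum, Finset.attach_eq_univ]
  refine (Finset.abs_sum_le_sum_abs _ _).trans ?_
  obtain ⟨T, hTsub, hTcard⟩ : ∃ T : Finset (ℕ × (Fin (d + 1) → ℤ)),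
      (∀ cq, cq ∈ keySet ℓ Mh (D.lev p.x.1) p.x.1 ∨ cq ∈ keySet ℓ Mh (D.lev p.x'.1) p.x'.1 → cq ∈ T)
        ∧ (T.card : ℝ) ≤ 6 * 2 ^ (d + 1) := by
    refine ⟨keySet ℓ Mh (D.lev p.x.1) p.x.1 ∪ keySet ℓ Mh (D.lev p.x'.1) p.x'.1, fun cq h => ?_, ?_⟩
    · simp only [Finset.mem_union]; exact h
    · have h1 := card_keySet_le ℓ Mh (D.lev p.x.1) p.x.1
      have h2 := card_keySet_le ℓ Mh (D.lev p.x'.1) p.x'.1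
      have u1 := Finset.card_union_le (keySet ℓ Mh (D.lev p.x.1) p.x.1) (keySet ℓ Mh (D.lev p.x'.1) p.x'.1)
      have h5 : (keySet ℓ Mh (D.lev p.x.1) p.x.1 ∪ keySet ℓ Mh (D.lev p.x'.1) p.x'.1).card ≤ 6 * 2 ^ (d + 1) := by
        omega
      exact_mod_cast h5
  have key := sum_le_card_mul
    (fun cq : {cq // cq ∈ cubeSet D} => |(supNorm (p.x'.1 - p.x.1)) ^ (-α)
        * ((((aX D a c hP cq.1 (cubeData_of_mem cq.2))ᵀ * (dMat (N0 ℓ Mh k P) μ)ᵀ) *ᵥ lam) p.x'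
          - (((aX D a c hP cq.1 (cubeData_of_mem cq.2))ᵀ * (dMat (N0 ℓ Mh k P) μ)ᵀ) *ᵥ lam) p.x)|)
    (fun cq => cq.1) Subtype.val_injective T
    (fun cq hq0 => by
      by_contra hmem
      apply hq0
      have hux : uX (ℓ := ℓ) (Mh := Mh) (k := k) (P := P) cq.1 p.x = 0 := by
        by_contra h
        exact hmem (hTsub _ (Or.inl (mem_keySet_of_uX_ne_zero hℓ hR hP hMh1 cq.1 (cubeData_of_mem cq.2) h)))
      have hux' : uX (ℓ := ℓ) (Mh := Mh) (k := k) (P := P) cq.1 p.x' = 0 := by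
        by_contra h
        exact hmem (hTsub _ (Or.inr (mem_keySet_of_uX_ne_zero hℓ hR hP hMh1 cq.1 (cubeData_of_mem cq.2) h)))
      rw [aXt_dMatt_mulVec hP cq.1 _ μ lam p.x, aXt_dMatt_mulVec hP cq.1 _ μ lam p.x',
        vX_eq_zero_of_uX cq.1 hux, vX_eq_zero_of_uX cq.1 hux']
      simp only [zero_mul, sub_self, mul_zero, abs_zero])
    hEnn (fun cq => hone cq.1 (cubeData_of_mem cq.2))
  refine key.trans ?_
  calc (T.card : ℝ) * E ≤ 6 * 2 ^ (d + 1) * E := mul_le_mul_of_nonneg_right hTcard hEnn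
    _ = 6 * 2 ^ (d + 1) * Q * LJ * E5 * B := by rw [hE]; ring
    _ ≤ (6 * 2 ^ (d + 1) * Q + 1) * LJ * E5 * B := by
        have : 0 ≤ LJ * E5 * B := by positivity
        nlinarith

/-- **THE PAIR ROWS OF `RᵀΛ` (THE COLUMNS OF `R` ON THE LEVEL-WEIGHTED INPUT) ARE `O(M_h^{−1})`, GENUINE `k`-LEVEL
OPERATOR**: for `0 ≤ α < 1` there are `δ, A > 0` such that (same quantifiers)
`|x̂−x|_∞^{−α}·|(RᵀΛf)(x̂) − (RᵀΛf)(x)| ≤ (A/M_h)·(L^{j})^{1−α}·e^{−δd(y,y′)/(d+1)}·sup|f|` — the terms of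
`Rᵀ = Σ_□ (K_□(h_□)G′(□)v_□)ᵀ` one by one (file 12 `bXt_dd_le`), at most `6·2^{d+1}` of them.
[cite: Balaban1984PropagatorsII, (2.44) p.230, (2.49)/(2.51) p.232, (2.64)–(2.67) p.234 (fifth entry)] -/
theorem dualPsi_rowBound (d ℓ : ℕ) (hℓ : 1 ≤ ℓ) (aminus aplus a2minus a2plus : ℝ) (ha : 0 < aminus)
    (ha2 : 0 < a2minus) (α : ℝ) (hα0 : 0 ≤ α) (hα1 : α < 1) :
    ∃ δ A : ℝ, 0 < δ ∧ 0 < A ∧ ∀ (k Mh R : ℕ), 3 ≤ Mh → 2 * (ℓ + 1) ≤ R →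
      ∀ (P : Fin (d + 1) → ℕ) (hP : ∀ μ, 1 ≤ P μ) (D : Domains d ℓ Mh k P R) (a c : ℕ → ℝ),
        (∀ i, 1 ≤ i → aminus ≤ a i ∧ a i ≤ aplus) → (∀ i, 1 ≤ i → a2minus ≤ c i ∧ c i ≤ a2plus) →
        ∀ (y' : ↥(bset D)) (lam : ↥(boxDom (N0 ℓ Mh k P)) → ℝ) (B : ℝ),
          BlockSupp (g := geom D) (blkOf D) lam y' B → ∀ p : BPair D,
          |dualOp D α ((rML D a c hP)ᵀ * levW D 1) lam p|
            ≤ A / Mh * (((ℓ : ℝ) + 1) ^ (blkB D p).1.1) ^ (1 - α)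
              * Real.exp (-(δ / (d + 1) * (geom D).dist (blkB D p) y')) * B := by
  obtain ⟨δ₆, Q, hδ₆, hQ, hterm⟩ := bXt_dd_le d ℓ hℓ aminus aplus a2minus a2plus ha ha2 α hα0 hα1
  refine ⟨δ₆, 6 * 2 ^ (d + 1) * Q + 1, hδ₆, by positivity, ?_⟩
  intro k Mh R hMh hR P hP D a c haw hcw y' lam B hlam p
  have hMh1 : 1 ≤ Mh := le_trans (by norm_num) hMh
  have hMhr : (1 : ℝ) ≤ Mh := by exact_mod_cast hMh1
  have hMh0 : (0 : ℝ) < Mh := by linarith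
  have hB0 : 0 ≤ B := hlam.nonneg
  have hlev : (blkB D p).1.1 = D.lev p.x.1 := rfl
  have hblkB : blkB D p = blkOf D p.x := rfl
  rw [hlev, hblkB]
  obtain ⟨E6, hE6⟩ : ∃ t : ℝ, t = Real.exp (-(δ₆ / (d + 1) * (geom D).dist (blkOf D p.x) y')) := ⟨_, rfl⟩
  obtain ⟨LJ, hLJ⟩ : ∃ t : ℝ, t = (((ℓ : ℝ) + 1) ^ D.lev p.x.1) ^ (1 - α) := ⟨_, rfl⟩
  rw [← hE6, ← hLJ]
  have hE60 : 0 ≤ E6 := by rw [hE6]; exact (Real.exp_pos _).le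
  have hLJ0 : 0 ≤ LJ := by rw [hLJ]; exact Real.rpow_nonneg (by positivity) _
  have hs0 : 0 < supNorm (p.x'.1 - p.x.1) :=
    lt_of_lt_of_le one_pos (B4StripSumsHolder.one_le_supNorm (sub_ne_zero.2 p.ne))
  have hW0 : 0 ≤ (supNorm (p.x'.1 - p.x.1)) ^ (-α) := Real.rpow_nonneg hs0.le _
  obtain ⟨g, hgdef⟩ : ∃ t : ↥(boxDom (N0 ℓ Mh k P)) → ℝ, t = levW D 1 *ᵥ lam := ⟨_, rfl⟩
  -- one term
  obtain ⟨E, hE⟩ : ∃ t : ℝ, t = LJ * (Q / Mh * E6 * B) := ⟨_, rfl⟩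
  have hEnn : 0 ≤ E := by rw [hE]; positivity
  have hone : ∀ (cq : ℕ × (Fin (d + 1) → ℤ)) (hc : CubeData D cq),
      |(supNorm (p.x'.1 - p.x.1)) ^ (-α)
        * (((bX D a c hP cq hc)ᵀ *ᵥ g) p.x' - ((bX D a c hP cq hc)ᵀ *ᵥ g) p.x)| ≤ E := by
    intro cq hc
    rw [abs_mul, abs_of_nonneg hW0, hE, hLJ, hE6, hgdef]
    exact hterm k Mh R hMh hR P hP D a c haw hcw y' lam B hlam p.x p.x' p.ne p.blk cq hc
  -- the sum over the cover
  rw [dualOp_apply, ← Matrix.mulVec_mulVec, ← hgdef]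
  unfold rML
  rw [Matrix.transpose_sum, Matrix.sum_mulVec, Finset.sum_apply, Finset.sum_apply, ← Finset.sum_sub_distrib,
    Finset.mul_sum, Finset.attach_eq_univ]
  refine (Finset.abs_sum_le_sum_abs _ _).trans ?_
  obtain ⟨T, hTsub, hTcard⟩ : ∃ T : Finset (ℕ × (Fin (d + 1) → ℤ)),
      (∀ cq, cq ∈ keySet ℓ Mh (D.lev p.x.1) p.x.1 ∨ cq ∈ keySet ℓ Mh (D.lev p.x'.1) p.x'.1 → cq ∈ T)
        ∧ (T.card : ℝ) ≤ 6 * 2 ^ (d + 1) := by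
    refine ⟨keySet ℓ Mh (D.lev p.x.1) p.x.1 ∪ keySet ℓ Mh (D.lev p.x'.1) p.x'.1, fun cq h => ?_, ?_⟩
    · simp only [Finset.mem_union]; exact h
    · have h1 := card_keySet_le ℓ Mh (D.lev p.x.1) p.x.1
      have h2 := card_keySet_le ℓ Mh (D.lev p.x'.1) p.x'.1
      have u1 := Finset.card_union_le (keySet ℓ Mh (D.lev p.x.1) p.x.1) (keySet ℓ Mh (D.lev p.x'.1) p.x'.1)
      have h5 : (keySet ℓ Mh (D.lev p.x.1) p.x.1 ∪ keySet ℓ Mh (D.lev p.x'.1) p.x'.1).card ≤ 6 * 2 ^ (d + 1) := by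
        omega
      exact_mod_cast h5
  have key := sum_le_card_mul
    (fun cq : {cq // cq ∈ cubeSet D} => |(supNorm (p.x'.1 - p.x.1)) ^ (-α)
        * (((bX D a c hP cq.1 (cubeData_of_mem cq.2))ᵀ *ᵥ g) p.x' - ((bX D a c hP cq.1 (cubeData_of_mem cq.2))ᵀ *ᵥ g) p.x)|)
    (fun cq => cq.1) Subtype.val_injective T
    (fun cq hq0 => by
      by_contra hmem
      apply hq0
      have hux : uX (ℓ := ℓ) (Mh := Mh) (k := k) (P := P) cq.1 p.x = 0 := by
        by_contra h
        exact hmem (hTsub _ (Or.inl (mem_keySet_of_uX_ne_zero hℓ hR hP hMh1 cq.1 (cubeData_of_mem cq.2) h)))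
      have hux' : uX (ℓ := ℓ) (Mh := Mh) (k := k) (P := P) cq.1 p.x' = 0 := by
        by_contra h
        exact hmem (hTsub _ (Or.inr (mem_keySet_of_uX_ne_zero hℓ hR hP hMh1 cq.1 (cubeData_of_mem cq.2) h)))
      rw [bXt_col_eq_zero_of_uX (D := D) (a := a) (c := c) hP cq.1 _ g hux,
        bXt_col_eq_zero_of_uX (D := D) (a := a) (c := c) hP cq.1 _ g hux']
      simp only [sub_self, mul_zero, abs_zero])
    hEnn (fun cq => hone cq.1 (cubeData_of_mem cq.2))
  refine key.trans ?_
  calc (T.card : ℝ) * E ≤ 6 * 2 ^ (d + 1) * E := mul_le_mul_of_nonneg_right hTcard hEnn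
    _ = (6 * 2 ^ (d + 1) * Q) / Mh * LJ * E6 * B := by rw [hE]; ring
    _ ≤ (6 * 2 ^ (d + 1) * Q + 1) / Mh * LJ * E6 * B := by
        have : 0 ≤ LJ * E6 * B := by positivity
        have h1 : (6 * 2 ^ (d + 1) * Q) / Mh ≤ (6 * 2 ^ (d + 1) * Q + 1) / Mh :=
          div_le_div_of_nonneg_right (by linarith) hMh0.le
        calc (6 * 2 ^ (d + 1) * Q) / Mh * LJ * E6 * B = (6 * 2 ^ (d + 1) * Q) / Mh * (LJ * E6 * B) := by ring
          _ ≤ (6 * 2 ^ (d + 1) * Q + 1) / Mh * (LJ * E6 * B) := mul_le_mul_of_nonneg_right h1 this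
          _ = _ := by ring

end RowBounds

/-! ## §3 Proposition 2.2, fifth entry, for the genuine `k`-level operator -/

section Prop22

variable {ℓ Mh k R : ℕ} {P : Fin (d + 1) → ℕ}

/-- **THE LIFTED FIFTH ENTRY HAS A MAJORANT** `C·(L^{j})^{1−α}·e^{−½δ₀d(y,y′)}` on `𝔅` (pairs of `B^j(y)` as rows):
for `0 ≤ α < 1` there are `δ₀, C, M₀ > 0`, `N₀ ≥ 1` (functions of `d`, `ℓ`, `α`, the windows) such that for every `k`,
`M_h ≥ 3` with `L·M_h ≥ M₀`, `R ≥ 2L` with `RM ≥ N₀ + 1`, volume, nested family `D`, weights in the windows with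
`a_{i+1} = aNext ℓ a_i c_i` and axis `μ`, the lift of `T = D_α∘(G′∂_μᵀ)` (`G′ = Δ′_a^{−1}`) has that majorant — the
lifted identity `T = T₀ + Ψ·Ṽ` (§1; transposed fixed point, no iteration), the pair-row bounds of `T₀` and `Ψ` (§2),
the majorant of `Ṽ = Λ^{−1}G′∂ᵀ` (the third entry, `B6Prop22AdjMultiLevelBox.prop22_third_multiLevelBox`, conjugated
by `Λ^{−1}`), the left convolution (2.54)+(2.61) and Lemma 2.1 on the box.
[cite: Balaban1984PropagatorsII, Proposition 2.2 (2.67) p.234 (fifth entry), (2.64)–(2.66) p.234] -/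
theorem hasMajorant_dualHolder_multiLevelBox (d ℓ : ℕ) (hℓ : 1 ≤ ℓ) (aminus aplus a2minus a2plus : ℝ)
    (ha : 0 < aminus) (ha2 : 0 < a2minus) (α : ℝ) (hα0 : 0 ≤ α) (hα1 : α < 1) :
    ∃ δ₀ C M₀ : ℝ, ∃ N₀ : ℕ, 0 < δ₀ ∧ 0 < C ∧ 0 < M₀ ∧ 0 < N₀ ∧
      ∀ (k Mh R : ℕ), 3 ≤ Mh → M₀ ≤ ((ℓ : ℝ) + 1) * Mh → 2 * (ℓ + 1) ≤ R → N₀ + 1 ≤ R * ((ℓ + 1) * Mh) →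
      ∀ (P : Fin (d + 1) → ℕ) (hP : ∀ μ, 1 ≤ P μ) (D : Domains d ℓ Mh k P R) (a c : ℕ → ℝ),
        (∀ i, 1 ≤ i → aminus ≤ a i ∧ a i ≤ aplus) → (∀ i, 1 ≤ i → a2minus ≤ c i ∧ c i ≤ a2plus) →
        (∀ i, 1 ≤ i → a (i + 1) = aNext ℓ (a i) (c i)) → ∀ μ : Fin (d + 1),
        HasMajorant (g := geom D) (Sum.elim (blkB D) (blkOf D))
          (liftL (dualOp D α (gml (N0 ℓ Mh k P) ℓ k D.lev a * (dMat (N0 ℓ Mh k P) μ)ᵀ)))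
          (fun y y' => C * (((ℓ : ℝ) + 1) ^ y.1.1) ^ (1 - α) * Real.exp (-(δ₀ / 2 * (geom D).dist y y'))) := by
  obtain ⟨δV, CV, M₀V, N₀V, hδV, hCV, hM₀V, hN₀V, hV⟩ :=
    prop22_third_multiLevelBox d ℓ hℓ aminus aplus a2minus a2plus ha ha2
  obtain ⟨δZ, AZ, hδZ, hAZ, hZ⟩ := dualZero_rowBound d ℓ hℓ aminus aplus a2minus a2plus ha ha2 α hα0 hα1
  obtain ⟨δΨ, AΨ, hδΨ, hAΨ, hΨ⟩ := dualPsi_rowBound d ℓ hℓ aminus aplus a2minus a2plus ha ha2 α hα0 hα1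
  have hL0 : (0 : ℝ) < (ℓ : ℝ) + 1 := by positivity
  have hL1 : (1 : ℝ) ≤ (ℓ : ℝ) + 1 := by linarith [(Nat.cast_nonneg ℓ : (0 : ℝ) ≤ ℓ)]
  -- the common rate
  set δ₀ : ℝ := min (δV / 2) (min δZ δΨ / (d + 1)) with hδ₀
  have hδ₀pos : 0 < δ₀ := by rw [hδ₀]; exact lt_min (half_pos hδV) (div_pos (lt_min hδZ hδΨ) (by positivity))
  have hδ₀V : δ₀ ≤ δV / 2 := by rw [hδ₀]; exact min_le_left _ _
  have hδ₀Z : δ₀ ≤ δZ / (d + 1) := by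
    rw [hδ₀]; exact (min_le_right _ _).trans (div_le_div_of_nonneg_right (min_le_left _ _) (by positivity))
  have hδ₀Ψ : δ₀ ≤ δΨ / (d + 1) := by
    rw [hδ₀]; exact (min_le_right _ _).trans (div_le_div_of_nonneg_right (min_le_right _ _) (by positivity))
  -- the (2.59)-threshold (ours and the third entry's)
  set N₀ : ℕ := ⌈4 * ((d : ℝ) + 1) * ((ℓ : ℝ) + 1) / (1 / 2 * δ₀)⌉₊ + 1 + N₀V with hN₀
  have hN₀pos : 0 < N₀ := by rw [hN₀]; omega
  have hθlt : Real.exp (-(1 / 2 * δ₀)) * ((ℓ : ℝ) + 1) ^ ((2 * (d + 1 : ℕ) : ℝ) / N₀) < 1 := by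
    refine theta_lt_one_of_log hL0 hN₀pos ?_
    have hlog : Real.log ((ℓ : ℝ) + 1) ≤ (ℓ : ℝ) + 1 := (Real.log_le_sub_one_of_pos hL0).trans (by linarith)
    have hN₀ge : 4 * ((d : ℝ) + 1) * ((ℓ : ℝ) + 1) / (1 / 2 * δ₀) < (N₀ : ℝ) := by
      rw [hN₀]; push_cast
      have h0 : (0 : ℝ) ≤ (N₀V : ℝ) := Nat.cast_nonneg _
      exact lt_of_le_of_lt (Nat.le_ceil _) (by linarith)
    have hσ : (0 : ℝ) < 1 / 2 * δ₀ := by positivity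
    rw [div_lt_iff₀ hσ] at hN₀ge
    push_cast
    nlinarith [mul_nonneg (by positivity : (0 : ℝ) ≤ 2 * ((d : ℝ) + 1)) (Real.log_nonneg hL1)]
  set cK : ℝ := K261 N₀ (d + 1) ((ℓ : ℝ) + 1) 1 (1 / 2 * δ₀) with hcK
  have hcK0 : 0 ≤ cK := K261_nonneg (by positivity) zero_le_one
  refine ⟨δ₀, AZ + AΨ * CV * cK + 1, M₀V, N₀, hδ₀pos, by positivity, hM₀V, hN₀pos, ?_⟩
  intro k Mh R hMh hM hR hRM P hP D a c haw hcw hac μ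
  have hMh1 : 1 ≤ Mh := le_trans (by norm_num) hMh
  have hMhr : (1 : ℝ) ≤ Mh := by exact_mod_cast hMh1
  have hMh0 : (0 : ℝ) < Mh := by linarith
  have hRMV : N₀V + 1 ≤ R * ((ℓ + 1) * Mh) := le_trans (by rw [hN₀]; omega) hRM
  have hapos : ∀ j, 1 ≤ j → 0 < a j := fun j hj => lt_of_lt_of_le ha (haw j hj).1
  have hcpos : ∀ j, 1 ≤ j → 0 < c j := fun j hj => lt_of_lt_of_le ha2 (hcw j hj).1
  -- geometry of the box
  obtain ⟨-, h261, -, -⟩ := lemma21_box D hMh1 hP hN₀pos hRM hδ₀pos.le (α := 1 / 2) (by norm_num)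
    (by norm_num) hθlt
  obtain ⟨htri, hrefl, hdnn⟩ := triangle_refl_nonneg D hMh1 hP
  have hsymm : ∀ a b : (geom D).Site, (geom D).dist a b = (geom D).dist b a := fun a b => by
    show (((bond D).dist a b : ℕ) : ℝ) = (((bond D).dist b a : ℕ) : ℝ)
    rw [SimpleGraph.dist_comm]
  have hαδ : (0 : ℝ) ≤ (1 - 1 / 2) * δ₀ := by nlinarith [hδ₀pos.le]
  -- the majorant of `Ṽ = Λ^{−1}G′∂ᵀ` (third entry, conjugated), lifted
  have hVmaj := hV k Mh R hMh hM hR hRMV P hP D a c haw hcw hac μ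
  have hVt : HasMajorant (g := geom D) (blkOf D)
      (Matrix.toLin' (levW D (-1) * (gml (N0 ℓ Mh k P) ℓ k D.lev a * (dMat (N0 ℓ Mh k P) μ)ᵀ)))
      (fun y y' => CV * Real.exp (-(δ₀ * (geom D).dist y y'))) := by
    rw [levW_neg_one_eq]
    refine hasMajorant_mono (g := geom D) (blkOf D)
      (hasMajorant_diagonal_mul (g := geom D) (blkOf D) (fun y : ↥(bset D) => (((ℓ : ℝ) + 1) ^ y.1.1)⁻¹)
        (fun y => by positivity) _ hVmaj) fun y y' => ?_
    have hLy : (0 : ℝ) < ((ℓ : ℝ) + 1) ^ y.1.1 := by positivity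
    have hexp : Real.exp (-(δV / 2 * (geom D).dist y y')) ≤ Real.exp (-(δ₀ * (geom D).dist y y')) :=
      Real.exp_le_exp.2 (by nlinarith [hdnn y y', hδ₀V])
    calc (((ℓ : ℝ) + 1) ^ y.1.1)⁻¹ * (CV * ((ℓ : ℝ) + 1) ^ y.1.1 * Real.exp (-(δV / 2 * (geom D).dist y y')))
        = CV * Real.exp (-(δV / 2 * (geom D).dist y y')) := by field_simp
      _ ≤ CV * Real.exp (-(δ₀ * (geom D).dist y y')) := mul_le_mul_of_nonneg_left hexp hCV.le
  have hVlift := hasMajorant_liftR (g := geom D) (blkOf D) (blkB D)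
    (K := fun y y' => CV * Real.exp (-(δ₀ * (geom D).dist y y'))) (fun y y' => by positivity) hVt
  -- the majorants of the lifted `Ψ` and `T₀` (pair rows, §2)
  have hΨm : HasMajorant (g := geom D) (Sum.elim (blkB D) (blkOf D))
      (liftL (dualOp D α ((rML D a c hP)ᵀ * levW D 1)))
      (fun y y' => AΨ / Mh * (((ℓ : ℝ) + 1) ^ y.1.1) ^ (1 - α)
        * Real.exp (-((1 - 1 / 2) * δ₀ * (geom D).dist y y'))) := by
    refine hasMajorant_liftL (g := geom D) (blkOf D) (blkB D)
      (K := fun y y' => AΨ / Mh * (((ℓ : ℝ) + 1) ^ y.1.1) ^ (1 - α)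
        * Real.exp (-((1 - 1 / 2) * δ₀ * (geom D).dist y y')))
      (fun y y' => by positivity) fun y' lam B hlam p => ?_
    refine (hΨ k Mh R hMh hR P hP D a c haw hcw y' lam B hlam p).trans ?_
    refine mul_le_mul_of_nonneg_right (mul_le_mul_of_nonneg_left (Real.exp_le_exp.2 ?_) (by positivity)) hlam.nonneg
    have h1 : (1 - 1 / 2) * δ₀ ≤ δΨ / (d + 1) := by linarith
    nlinarith [hdnn (blkB D p) y', h1]
  have hZm : HasMajorant (g := geom D) (Sum.elim (blkB D) (blkOf D))
      (liftL (dualOp D α ((gZeroML D a c hP)ᵀ * (dMat (N0 ℓ Mh k P) μ)ᵀ)))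
      (fun y y' => AZ * (((ℓ : ℝ) + 1) ^ y.1.1) ^ (1 - α)
        * Real.exp (-((1 - 1 / 2) * δ₀ * (geom D).dist y y'))) := by
    refine hasMajorant_liftL (g := geom D) (blkOf D) (blkB D)
      (K := fun y y' => AZ * (((ℓ : ℝ) + 1) ^ y.1.1) ^ (1 - α)
        * Real.exp (-((1 - 1 / 2) * δ₀ * (geom D).dist y y')))
      (fun y y' => by positivity) fun y' lam B hlam p => ?_
    refine (hZ k Mh R hMh hR P hP D a c haw hcw μ y' lam B hlam p).trans ?_
    refine mul_le_mul_of_nonneg_right (mul_le_mul_of_nonneg_left (Real.exp_le_exp.2 ?_) (by positivity)) hlam.nonneg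
    have h1 : (1 - 1 / 2) * δ₀ ≤ δZ / (d + 1) := by linarith
    nlinarith [hdnn (blkB D p) y', h1]
  -- the product `Ψ·Ṽ` and the left convolution
  have hprod := hasMajorant_mul (g := geom D) (Sum.elim (blkB D) (blkOf D))
    (K₂ := fun y y' => CV * Real.exp (-(δ₀ * (geom D).dist y y'))) hΨm hVlift
    (fun y y' => mul_nonneg hCV.le (Real.exp_pos _).le)
  have hprod' : HasMajorant (g := geom D) (Sum.elim (blkB D) (blkOf D))
      (liftL (dualOp D α ((rML D a c hP)ᵀ * levW D 1))
        * liftR (Matrix.toLin' (levW D (-1) * (gml (N0 ℓ Mh k P) ℓ k D.lev a * (dMat (N0 ℓ Mh k P) μ)ᵀ))))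
      (fun y y' => AΨ / Mh * (((ℓ : ℝ) + 1) ^ y.1.1) ^ (1 - α) * CV * cK
        * Real.exp (-((1 - 1 / 2) * δ₀ * (geom D).dist y y'))) :=
    hasMajorant_mono (g := geom D) (Sum.elim (blkB D) (blkOf D)) hprod fun y y' =>
      conv_left_le hαδ htri hsymm h261 (r := AΨ / Mh * (((ℓ : ℝ) + 1) ^ y.1.1) ^ (1 - α)) (A := CV)
        (by positivity) hCV.le y y'
  -- the lifted identity and the sum
  rw [dual_identity D (c := c) hℓ hR hP hMh1 hapos hcpos hac α ((dMat (N0 ℓ Mh k P) μ)ᵀ)]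
  have hsum := hasMajorant_add (g := geom D) (Sum.elim (blkB D) (blkOf D)) hZm hprod'
  refine hasMajorant_mono (g := geom D) (Sum.elim (blkB D) (blkOf D)) hsum fun y y' => ?_
  have he : Real.exp (-((1 - 1 / 2) * δ₀ * (geom D).dist y y')) = Real.exp (-(δ₀ / 2 * (geom D).dist y y')) := by
    congr 1; ring
  rw [he]
  have hP0 : 0 ≤ (((ℓ : ℝ) + 1) ^ y.1.1) ^ (1 - α) := Real.rpow_nonneg (by positivity) _
  have he0 : 0 ≤ Real.exp (-(δ₀ / 2 * (geom D).dist y y')) := (Real.exp_pos _).le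
  have h1 : AΨ / Mh ≤ AΨ := div_le_self hAΨ.le hMhr
  have h2 : AΨ / Mh * (CV * cK) ≤ AΨ * (CV * cK) := mul_le_mul_of_nonneg_right h1 (mul_nonneg hCV.le hcK0)
  calc AZ * (((ℓ : ℝ) + 1) ^ y.1.1) ^ (1 - α) * Real.exp (-(δ₀ / 2 * (geom D).dist y y'))
        + AΨ / Mh * (((ℓ : ℝ) + 1) ^ y.1.1) ^ (1 - α) * CV * cK * Real.exp (-(δ₀ / 2 * (geom D).dist y y'))
      = (AZ + AΨ / Mh * (CV * cK)) * ((((ℓ : ℝ) + 1) ^ y.1.1) ^ (1 - α) * Real.exp (-(δ₀ / 2 * (geom D).dist y y'))) := by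
        ring
    _ ≤ (AZ + AΨ * CV * cK + 1) * ((((ℓ : ℝ) + 1) ^ y.1.1) ^ (1 - α) * Real.exp (-(δ₀ / 2 * (geom D).dist y y'))) :=
        mul_le_mul_of_nonneg_right (by linarith) (mul_nonneg hP0 he0)
    _ = (AZ + AΨ * CV * cK + 1) * (((ℓ : ℝ) + 1) ^ y.1.1) ^ (1 - α) * Real.exp (-(δ₀ / 2 * (geom D).dist y y')) := by
        ring

/-- **[B6] PROPOSITION 2.2, FIFTH ENTRY OF (2.67) (`‖ζG′∇^{η*}λ‖_α`), FOR THE GENUINE `k`-LEVEL OPERATOR `G′ = Δ′_a^{−1}`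
ON A BOX**: for `0 ≤ α < 1` there are `δ₀, C, M₀ > 0` and `N₀ ≥ 1` (functions of `d`, `ℓ`, `α`, the windows) such that
for EVERY number of levels `k`, `M_h ≥ 3` with `L·M_h ≥ M₀` («M is sufficiently large»), `R ≥ 2L` with `RM ≥ N₀ + 1`
((2.59)), volume `P`, nested family `D` of domains (2.1)–(2.2), weights `a_i ∈ [a₋, a₊]`, `c_i ∈ [c₋, c₊]` with
`a_{i+1} = aNext ℓ a_i c_i`, axis `μ`, and all `x ≠ x̂` of one block `B^j(y)`, `y ∈ Λ_j`:
`|x̂−x|_∞^{−α}·|(G′∂_μᵀλ)(x̂) − (G′∂_μᵀλ)(x)| ≤ C·(L^{j})^{1−α}·e^{−½δ₀d(y,y′)}·|λ|`, `supp λ ⊂ B^{j′}(y′)`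
(`(G′∂ᵀλ)(x) = Σ_z[G′(x,z+e_μ) − G′(x,z)]λ(z)`; lattice units: `G′` is `η^{−2}G′` of print and `∂ᵀ` is `η∇^{η*}` up to
the unit, whence `(L^{j})^{1−α}` for «(L^jη)^{1−α}»; the Hölder quotient over the pairs of `B^j(y)`, the cut-off `ζ` and
the factor `(‖ζ‖_α + |ζ|)` of print being dispensed with as in [3] (1.9)) — by the printed route: the transposed fixed
point `G′∂ᵀ = G′₀ᵀ∂ᵀ + Rᵀ(G′∂ᵀ)` differenced over pairs, the pair-row bounds of `G′₀ᵀ∂ᵀ` and of `RᵀΛ` (§2), the third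
entry for `Λ^{−1}G′∂ᵀ`, the left convolution and Lemma 2.1.
[cite: Balaban1984PropagatorsII, Proposition 2.2 (2.67) p.234 (fifth entry «(L^jη)^{1−α}(‖ζ‖_α + |ζ|)»), (2.64)–(2.66) p.234; Balaban1983RegularityDecay, Theorem (1.9) p.573] -/
theorem prop22_fifth_multiLevelBox (d ℓ : ℕ) (hℓ : 1 ≤ ℓ) (aminus aplus a2minus a2plus : ℝ) (ha : 0 < aminus)
    (ha2 : 0 < a2minus) (α : ℝ) (hα0 : 0 ≤ α) (hα1 : α < 1) :
    ∃ δ₀ C M₀ : ℝ, ∃ N₀ : ℕ, 0 < δ₀ ∧ 0 < C ∧ 0 < M₀ ∧ 0 < N₀ ∧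
      ∀ (k Mh R : ℕ), 3 ≤ Mh → M₀ ≤ ((ℓ : ℝ) + 1) * Mh → 2 * (ℓ + 1) ≤ R → N₀ + 1 ≤ R * ((ℓ + 1) * Mh) →
      ∀ (P : Fin (d + 1) → ℕ) (hP : ∀ μ, 1 ≤ P μ) (D : Domains d ℓ Mh k P R) (a c : ℕ → ℝ),
        (∀ i, 1 ≤ i → aminus ≤ a i ∧ a i ≤ aplus) → (∀ i, 1 ≤ i → a2minus ≤ c i ∧ c i ≤ a2plus) →
        (∀ i, 1 ≤ i → a (i + 1) = aNext ℓ (a i) (c i)) →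
        ∀ (μ : Fin (d + 1)) (y' : ↥(bset D)) (lam : ↥(boxDom (N0 ℓ Mh k P)) → ℝ) (B : ℝ),
          BlockSupp (g := geom D) (blkOf D) lam y' B →
          ∀ (x x' : ↥(boxDom (N0 ℓ Mh k P))), x'.1 ≠ x.1 → blkOf D x' = blkOf D x →
            (supNorm (x'.1 - x.1)) ^ (-α)
                * |((gml (N0 ℓ Mh k P) ℓ k D.lev a * (dMat (N0 ℓ Mh k P) μ)ᵀ) *ᵥ lam) x'
                    - ((gml (N0 ℓ Mh k P) ℓ k D.lev a * (dMat (N0 ℓ Mh k P) μ)ᵀ) *ᵥ lam) x|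
              ≤ C * (((ℓ : ℝ) + 1) ^ D.lev x.1) ^ (1 - α) * Real.exp (-(δ₀ / 2 * (geom D).dist (blkOf D x) y')) * B := by
  obtain ⟨δ₀, C, M₀, N₀, hδ₀, hC, hM₀, hN₀, h⟩ :=
    hasMajorant_dualHolder_multiLevelBox d ℓ hℓ aminus aplus a2minus a2plus ha ha2 α hα0 hα1
  refine ⟨δ₀, C, M₀, N₀, hδ₀, hC, hM₀, hN₀, ?_⟩
  intro k Mh R hMh hM hR hRM P hP D a c haw hcw hac μ y' lam B hlam x x' hne hblk
  have hmaj := h k Mh R hMh hM hR hRM P hP D a c haw hcw hac μ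
  have hrow := rowBound_of_hasMajorant_liftL (g := geom D) (blkOf D) (blkB D) hmaj y' lam B hlam
    (⟨x, x', hne, hblk⟩ : BPair D)
  rw [dualOp_apply, abs_mul, abs_of_nonneg (Real.rpow_nonneg (supNorm_nonneg _) _)] at hrow
  exact hrow

end Prop22

end

end Literature.MathematicalPhysics.QuantumFieldTheory.Balaban1983to89.B6Prop22DualHolderMultiLevelBox
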